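import Literature.NumberTheory.PAdicHodge.DualExpEllipticTowerSelf
import Literature.NumberTheory.GaloisRepresentations.RestrictConjugateIso
import HarnessLib

/-!
# `exp*_ω` under restriction to a finite extension: the DIRECT representation over `F` versus the tower representation

Topic `Literature/NumberTheory/PAdicHodge`; THEOREMS ONLY (no definition, no named fact, no instance, no `sorry`). Companion of
`DualExpEllipticTower` (`expStarCoordTower`: `exp*_ω` on the TOWER representation `V_pW|_{Γ_{F₀}}|_{Γ_F}`) and of
`EllipticCurves/LocalTatePairingRestriction` (the local Tate pairing with points under the restriction
`Res = H¹(res_{F/F₀}; T(τ)) : H¹(F₀, T_pW|_{Γ_{F₀}}) → H¹(F, T_pW|_{Γ_F})` to the DIRECT representation over `F`, `τ ∈ Γ_{K₀}` the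
embedding element of the tower `K₀ ⊆ F₀ ⊆ F`). Kato's formula over `F` is stated for the direct representation `V_pW|_{Γ_F}` (capstone
`TatePairingPointOfKTwo…`, [REC] `tatePairingPoint_eq_trace_expStar_log`); to DESCEND it to `F₀` one evaluates it at `Res η₀` and needs
`exp*` there. This file identifies the two:

* `exists_ratGalEquiv`, `ratGalEquiv_intertwines` — `V(τ) : V_pW ≃ V_pW` (any `gV` with `gV m = ρ(τ) m`) intertwines the tower representation with the direct one (`res_{F/K₀} = τ·(res_{F₀/K₀}∘res_{F/F₀})·τ⁻¹`).
* ★ `expStarCoord_map_res_eq_expStarCoordTower` — for a line datum `d` of the TOWER representation and its transport `d.map V(τ)` to the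
  direct representation (`FilZeroLine.map`), and every `η₀ ∈ Z¹(Γ_{F₀}, T_pW)`:
  `exp*_{d.map V(τ)}(Res η₀) = exp*_d(η₀ ∘ res)` (`dualExpCoord_map`: `exp*` is invariant under transport of cocycle AND generator); hence,
  under the compatibility clause of hT₂ / [REC-tower] (`exp*_d(η₀ ∘ res) = (F₀ → F)(exp*_{d₀} η₀)`), ★ `expStarCoord_map_res_eq_algebraMap`:
  **`exp*_{d.map V(τ)}(Res η₀) = algebraMap F₀ F (exp*_{d₀}(η₀))`**.
* `cupLogInjective_res_of_tower` — the Prop-1.2.3 injectivity binder passes from the tower representation to the direct one (`cupLogInjective_of_equiv`).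

Crux K★ `stmt-BirchSwinnertonDyer-22226` (memo `…/kato-lever-K3-legendre.md` §7.2 gap 2, brick D5); BSD / K★ are not proved by this file.

## References
* K. Kato, LNM 1553 (1993), Ch. II §1.2.4 (functoriality of `exp*`), Prop. 1.2.3. [Kato1993LNM1553]
* J.-P. Serre, *Galois Cohomology* (1997), I §2.4 (compatible pairs), I §5.8. [SerreGaloisCohomology1997]
-/

noncomputable section

open scoped TensorProduct NNReal
open CategoryTheory Field ValuativeRel Function
open Literature.NumberTheory.GaloisRepresentations
open Literature.NumberTheory.GaloisRepresentations.IsNonarchimedeanLocalField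
open Literature.NumberTheory.GaloisRepresentations.PeriodRingData
open Literature.NumberTheory.EllipticCurves WeierstrassCurve

namespace Literature.NumberTheory.PAdicHodge

variable {K₀ : Type} [Field K₀] [CharZero K₀] (W : WeierstrassCurve K₀) [W.IsElliptic]
  (F₀ : Type) [Field F₀] [Algebra K₀ F₀]
  {F : Type} [Field F] [Algebra K₀ F] [Algebra F₀ F] [IsScalarTower K₀ F₀ F]
  [ValuativeRel F] [TopologicalSpace F] [IsNonarchimedeanLocalField F] [CharZero F]
  {p : ℕ} [Fact p.Prime] [Fact (¬ IsUnit (p : integerC F))] [IsAdicComplete (Ideal.span {(p : integerC F)}) (integerC F)]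
  (hp : valuation F p < 1) [Algebra ℚ_[p] F]
  {τ : absoluteGaloisGroup K₀}
  (hconj : ∀ σ : absoluteGaloisGroup F,
    absGaloisRestrict K₀ F σ = τ * ((absGaloisRestrict K₀ F₀).comp (absGaloisRestrict F₀ F)) σ * τ⁻¹)

/-! ### §1 The intertwiner `V(τ)` -/

omit [CharZero K₀] [IsScalarTower K₀ F₀ F] [ValuativeRel F] [TopologicalSpace F] [IsNonarchimedeanLocalField F] [CharZero F]
  [Fact (¬ IsUnit (p : integerC F))] [IsAdicComplete (Ideal.span {(p : integerC F)}) (integerC F)] [Algebra ℚ_[p] F]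
  [Algebra K₀ F₀] [Algebra K₀ F] [Algebra F₀ F] in
/-- **`V(τ)` as a linear automorphism of `V_pW`** (inverse `V(τ⁻¹)`): existence of a `ℚ_p`-linear equivalence acting as `ρ(τ)`.
[cite: SerreGaloisCohomology1997, I §2.4 (compatible pairs)] -/
theorem exists_ratGalEquiv (τ : absoluteGaloisGroup K₀) :
    ∃ gV : W.rationalTateModule p ≃ₗ[ℚ_[p]] W.rationalTateModule p, ∀ m, gV m = (W.rationalTateGaloisRep p (W.continuous_rationalGaloisRepTate_holds p)) τ m := by
  have h₁ : ((W.rationalTateGaloisRep p (W.continuous_rationalGaloisRepTate_holds p)) τ⁻¹).comp ((W.rationalTateGaloisRep p (W.continuous_rationalGaloisRepTate_holds p)) τ : W.rationalTateModule p →ₗ[ℚ_[p]] W.rationalTateModule p) = LinearMap.id := by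
    rw [← Module.End.mul_eq_comp, ← map_mul, inv_mul_cancel, map_one, Module.End.one_eq_id]
  have h₂ : ((W.rationalTateGaloisRep p (W.continuous_rationalGaloisRepTate_holds p)) τ).comp ((W.rationalTateGaloisRep p (W.continuous_rationalGaloisRepTate_holds p)) τ⁻¹ : W.rationalTateModule p →ₗ[ℚ_[p]] W.rationalTateModule p) = LinearMap.id := by
    rw [← Module.End.mul_eq_comp, ← map_mul, mul_inv_cancel, map_one, Module.End.one_eq_id]
  exact ⟨LinearEquiv.ofLinear ((W.rationalTateGaloisRep p (W.continuous_rationalGaloisRepTate_holds p)) τ : W.rationalTateModule p →ₗ[ℚ_[p]] W.rationalTateModule p)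
    ((W.rationalTateGaloisRep p (W.continuous_rationalGaloisRepTate_holds p)) τ⁻¹ : W.rationalTateModule p →ₗ[ℚ_[p]] W.rationalTateModule p) h₂ h₁, fun _ => rfl⟩

variable {gV : W.rationalTateModule p ≃ₗ[ℚ_[p]] W.rationalTateModule p}
  (hgVdef : ∀ m, gV m = (W.rationalTateGaloisRep p (W.continuous_rationalGaloisRepTate_holds p)) τ m)

omit [CharZero K₀] [IsScalarTower K₀ F₀ F] [ValuativeRel F] [TopologicalSpace F] [IsNonarchimedeanLocalField F] [CharZero F]
  [Fact (¬ IsUnit (p : integerC F))] [IsAdicComplete (Ideal.span {(p : integerC F)}) (integerC F)] [Algebra ℚ_[p] F] in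
include hconj hgVdef in
/-- **`V(τ)` intertwines the tower representation `V_pW|_{Γ_{F₀}}|_{Γ_F}` with the direct one `V_pW|_{Γ_F}`**:
`V(τ) ∘ V(res_{F₀/K₀}(res_{F/F₀} σ)) = V(res_{F/K₀} σ) ∘ V(τ)`. [cite: SerreGaloisCohomology1997, I §2.4 (compatible pairs)] -/
theorem ratGalEquiv_intertwines (σ : absoluteGaloisGroup F) (m : W.rationalTateModule p) :
    gV (((restrictedRationalTateRep W F₀ p).restrict (absGaloisRestrict F₀ F)) σ m) = restrictedRationalTateRep W F p σ (gV m) := by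
  rw [hgVdef, hgVdef, ContinuousRep.restrict_apply]
  change ((W.rationalTateGaloisRep p (W.continuous_rationalGaloisRepTate_holds p)) τ) (((W.rationalTateGaloisRep p (W.continuous_rationalGaloisRepTate_holds p)) (absGaloisRestrict K₀ F₀ (absGaloisRestrict F₀ F σ))) m) =
    ((W.rationalTateGaloisRep p (W.continuous_rationalGaloisRepTate_holds p)) (absGaloisRestrict K₀ F σ)) (((W.rationalTateGaloisRep p (W.continuous_rationalGaloisRepTate_holds p)) τ) m)
  rw [hconj σ, map_mul, map_mul, Module.End.mul_apply, Module.End.mul_apply,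
    ← Module.End.mul_apply ((W.rationalTateGaloisRep p (W.continuous_rationalGaloisRepTate_holds p)) τ⁻¹), ← map_mul, inv_mul_cancel, map_one, Module.End.one_apply]
  rfl

/-! ### §2 The Prop-1.2.3 injectivity binder passes to the direct representation -/

omit [CharZero K₀] [IsScalarTower K₀ F₀ F] in
include hconj hgVdef in
/-- `CupLogInjective` for the tower representation implies it for the direct representation over `F` (transport along `V(τ)`).
[cite: Kato1993LNM1553, Ch. II Prop. 1.2.3 and §1.2.4] -/
theorem cupLogInjective_res_of_tower
    (hinj : (bdRPeriodRingData (F := F) (p := p) hp).CupLogInjective (logCyclotomic p)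
      ((restrictedRationalTateRep W F₀ p).restrict (absGaloisRestrict F₀ F))) :
    (bdRPeriodRingData (F := F) (p := p) hp).CupLogInjective (logCyclotomic p) (restrictedRationalTateRep W F p) :=
  cupLogInjective_of_equiv gV (ratGalEquiv_intertwines W F₀ hconj hgVdef) hinj

/-! ### §3 `exp*` of a restricted cocycle -/

omit [CharZero K₀] [IsScalarTower K₀ F₀ F] in
include hgVdef in
/-- ★ **`exp*` of a restricted cocycle on the DIRECT representation equals `exp*` on the tower representation**: for a line datum `d` of the
tower representation transported along `V(τ)` (`FilZeroLine.map`), every `η₀ ∈ Z¹(Γ_{F₀}, T_pW|)`, with `Res η₀ = T(τ) ∘ η₀ ∘ res` (a cocycle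
of `T_pW|_{Γ_F}`) and `η₀ ∘ res` (a cocycle of the tower representation): `exp*_{d.map V(τ)}(Res η₀) = exp*_d(η₀ ∘ res)` — transport
invariance of the scalar dual exponential (`FilZeroLine.dualExpCoord_map`), under the Prop-1.2.3 binders of the tower representation.
[cite: Kato1993LNM1553, Ch. II §1.2.4 and Prop. 1.2.3] [cite: SerreGaloisCohomology1997, I §5.8] -/
theorem expStarCoord_map_res_eq_expStarCoordTower
    (hinj : (bdRPeriodRingData (F := F) (p := p) hp).CupLogInjective (logCyclotomic p)
      ((restrictedRationalTateRep W F₀ p).restrict (absGaloisRestrict F₀ F)))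
    (hde : ∀ z : contOneCocycles ((restrictedRationalTateRep W F₀ p).restrict (absGaloisRestrict F₀ F)).toTopRep,
      (bdRPeriodRingData (F := F) (p := p) hp).HasDualExp (logCyclotomic p)
        ((restrictedRationalTateRep W F₀ p).restrict (absGaloisRestrict F₀ F)) fun σ => z.1 σ)
    (d : (bdRPeriodRingData (F := F) (p := p) hp).FilZeroLine ((restrictedRationalTateRep W F₀ p).restrict (absGaloisRestrict F₀ F)))
    (η₀ : contOneCocycles (restrictedTateRep W F₀ p).toTopRep) :
    expStarCoord W hp (d.map gV (ratGalEquiv_intertwines W F₀ hconj hgVdef))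
        (contOneCocycles.pullback (absGaloisRestrict F₀ F)
          ((W.tateGaloisRep p (W.continuous_galoisRepTate_holds p)).toIntRep.restrictConjHom
            ((absGaloisRestrict K₀ F₀).comp (absGaloisRestrict F₀ F)) (absGaloisRestrict K₀ F) τ hconj) η₀) =
      expStarCoordTower W hp d (contOneCocycles.pullback (absGaloisRestrict F₀ F) (𝟙 _) η₀) := by
  -- the rational cochain of the tower cocycle `η₀ ∘ res` is a continuous cocycle: its dual-exp existence
  have hz := hde ⟨⟨fun σ => TateModule.toRational p ((contOneCocycles.pullback (absGaloisRestrict F₀ F) (𝟙 _) η₀).1 σ),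
      (by
        haveI := W.module_finite_tateModule_holds p
        exact (TateModule.continuous_toRational (A := geomPoints W) (p := p)).comp
          (contOneCocycles.pullback (absGaloisRestrict F₀ F) (𝟙 _) η₀).1.continuous)⟩,
    fun g h => by
      change TateModule.toRational p ((contOneCocycles.pullback (absGaloisRestrict F₀ F) (𝟙 _) η₀).1 (g * h)) = _
      rw [(contOneCocycles.pullback (absGaloisRestrict F₀ F) (𝟙 _) η₀).2 g h, map_add]
      rfl⟩
  have key := FilZeroLine.dualExpCoord_map d gV (ratGalEquiv_intertwines W F₀ hconj hgVdef) hinj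
    (cupLogInjective_res_of_tower W F₀ hp hconj hgVdef hinj) hz
  -- both sides are `dualExpCoord` of cochains that agree pointwise
  unfold expStarCoord expStarCoordTower
  refine Eq.trans (congrArg _ (funext fun σ => ?_)) key
  change TateModule.toRational p ((W.tateGaloisRep p (W.continuous_galoisRepTate_holds p)).toIntRep τ (η₀.1 (absGaloisRestrict F₀ F σ))) =
    gV (TateModule.toRational p (η₀.1 (absGaloisRestrict F₀ F σ)))
  rw [hgVdef]
  rfl

omit [CharZero K₀] [IsScalarTower K₀ F₀ F] in
include hgVdef in
/-- ★ **`exp*_{d.map V(τ)}(Res η₀) = algebraMap F₀ F (exp*_{d₀}(η₀))`** under the compatibility clause of hT₂ / [REC-tower]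
(`exp*_d(η) = (F₀ → F)(exp*_{d₀}(η₀))` whenever `η = η₀ ∘ res`; the cell's kernel theorem (RES) supplies such `d`). This is the form in which
Kato's formula over `F`, evaluated at `Res η₀`, reads in `F₀`. [cite: Kato1993LNM1553, Ch. II §1.2.4] -/
theorem expStarCoord_map_res_eq_algebraMap
    [ValuativeRel F₀] [TopologicalSpace F₀] [IsNonarchimedeanLocalField F₀] [CharZero F₀]
    [Fact (¬ IsUnit (p : integerC F₀))] [IsAdicComplete (Ideal.span {(p : integerC F₀)}) (integerC F₀)]
    (hp₀ : valuation F₀ p < 1) [Algebra ℚ_[p] F₀]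
    (hinj : (bdRPeriodRingData (F := F) (p := p) hp).CupLogInjective (logCyclotomic p)
      ((restrictedRationalTateRep W F₀ p).restrict (absGaloisRestrict F₀ F)))
    (hde : ∀ z : contOneCocycles ((restrictedRationalTateRep W F₀ p).restrict (absGaloisRestrict F₀ F)).toTopRep,
      (bdRPeriodRingData (F := F) (p := p) hp).HasDualExp (logCyclotomic p)
        ((restrictedRationalTateRep W F₀ p).restrict (absGaloisRestrict F₀ F)) fun σ => z.1 σ)
    (d₀ : (bdRPeriodRingData (F := F₀) (p := p) hp₀).FilZeroLine (restrictedRationalTateRep W F₀ p))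
    (d : (bdRPeriodRingData (F := F) (p := p) hp).FilZeroLine ((restrictedRationalTateRep W F₀ p).restrict (absGaloisRestrict F₀ F)))
    (hcomp : ∀ (η₀ : contOneCocycles (restrictedTateRep W F₀ p).toTopRep)
        (η : contOneCocycles ((restrictedTateRep W F₀ p).restrict (absGaloisRestrict F₀ F)).toTopRep),
        (∀ σ, η.1 σ = η₀.1 (absGaloisRestrict F₀ F σ)) →
        expStarCoordTower W hp d η = algebraMap F₀ F (expStarCoord W hp₀ d₀ η₀))
    (η₀ : contOneCocycles (restrictedTateRep W F₀ p).toTopRep) :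
    expStarCoord W hp (d.map gV (ratGalEquiv_intertwines W F₀ hconj hgVdef))
        (contOneCocycles.pullback (absGaloisRestrict F₀ F)
          ((W.tateGaloisRep p (W.continuous_galoisRepTate_holds p)).toIntRep.restrictConjHom
            ((absGaloisRestrict K₀ F₀).comp (absGaloisRestrict F₀ F)) (absGaloisRestrict K₀ F) τ hconj) η₀) =
      algebraMap F₀ F (expStarCoord W hp₀ d₀ η₀) := by
  rw [expStarCoord_map_res_eq_expStarCoordTower W F₀ hp hconj hgVdef hinj hde d η₀]
  exact hcomp η₀ _ fun σ => rfl

end Literature.NumberTheory.PAdicHodge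

end
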